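import Literature.NumberTheory.GaloisRepresentations.SuperellipticReductionPrincipal
import HarnessLib
/-!
# Reduction of `y^p = f(x)` modulo `𝔓`: the map on divisor classes; equivariance; injectivity on `J[λ]`

Part 4 of the explicit Deuring reduction.

* `redPic 𝔭 𝔓 : Pic(C_{f,K̄}) →+ Pic(C_{f̄,κ})`, `[D] ↦ [D̄]` (`redPic_mk`; well defined by
  `principalDivisors_le_comap_redDiv`), degree preserving (`degree_redPic`);
* equivariance for the decomposition group `D_𝔓` acting through `D_𝔓 → Aut(κ/(𝓞_K/𝔭))`
  (`Ideal.Quotient.stabilizerHom`; `redPlace_smul`, `redPic_smul`) and for the deck groups along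
  `μ_p(K̄) → μ_p(κ)` (`CyclicCoverDeck.reduceMod`; `redPlace_deck_smul`, `redPic_deck_smul`);
* the roots of `f` reduce bijectively onto the roots of `f̄` (`rootEquiv`), `T_α ↦ T_ᾱ` (`redPlace_rootPlace`), so
  `[∑ ã_α (T_α - ∞)] ↦ [∑ ã_α (T_ᾱ - ∞̄)]` (`redDiv_liftDivInf`) and, by the injectivity of `Ψ` on the special
  fibre (`psiInf_injective`), **`redPic` is injective on `J[1 - ζ]`** (`eq_zero_of_mem_lambdaTorsion_of_redPic_eq_zero`).

## References
* [cite: Deuring1942Reduktion, §§2, 4]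
* [cite: Schaefer1998, Prop. 3.2]
-/

noncomputable section

open Polynomial
open scoped NumberField Classical Polynomial.Bivariate Pointwise

namespace Literature.NumberTheory.GaloisRepresentations

open Field IsDedekindDomain Literature.NumberTheory.DiophantineGeometry
  Literature.NumberTheory.DiophantineGeometry.AlgFunctionField SuperellipticFunctionField

attribute [local instance] Ideal.Quotient.field

set_option synthInstance.maxHeartbeats 160000

namespace SuperellipticReduction

variable {K : Type} [Field K] [NumberField K] {p : ℕ} [hp : Fact p.Prime] {f₀ : (𝓞 K)[X]}
variable {𝔭 : HeightOneSpectrum (𝓞 K)} {𝔓 : Ideal (absIntegers (𝓞 K) K)} [h𝔓m : 𝔓.IsMaximal] [h𝔓 : 𝔓.LiesOver 𝔭.asIdeal]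

set_option hygiene false in
local notation "K̄" => AlgebraicClosure K
set_option hygiene false in
local notation "𝒪" => absIntegersLocalization 𝔓
set_option hygiene false in
local notation "κ" => (absIntegers (𝓞 K) K ⧸ 𝔓)
set_option hygiene false in
local notation "k𝔭" => (𝓞 K ⧸ 𝔭.asIdeal)
set_option hygiene false in
local notation "fK" => (Polynomial.map (algebraMap (𝓞 K) K) f₀)
set_option hygiene false in
local notation "fk" => (Polynomial.map (Ideal.Quotient.mk 𝔭.asIdeal) f₀)
set_option hygiene false in
local notation "FK" => SuperellipticFunctionField K (AlgebraicClosure K) p (Polynomial.map (algebraMap (𝓞 K) K) f₀)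
set_option hygiene false in
local notation "Fκ" =>
  SuperellipticFunctionField (𝓞 K ⧸ 𝔭.asIdeal) (absIntegers (𝓞 K) K ⧸ 𝔓) p (Polynomial.map (Ideal.Quotient.mk 𝔭.asIdeal) f₀)
set_option hygiene false in
/-- evaluation in the generic fibre -/
local notation "ev" =>
  polyEval K p (Polynomial.map (algebraMap (𝓞 K) K) f₀) (absIntegersLocalization 𝔓).subtype
set_option hygiene false in
/-- evaluation in the special fibre -/
local notation "evκ" =>
  polyEval (𝓞 K ⧸ 𝔭.asIdeal) p (Polynomial.map (Ideal.Quotient.mk 𝔭.asIdeal) f₀) (absIntegersResidue 𝔓)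
set_option hygiene false in
/-- the model `Y^p - f_𝒪` -/
local notation "gmod" => ((X : (absIntegersLocalization 𝔓)[X][Y]) ^ p - C (fLoc f₀ 𝔓))

variable [hirrK : Fact (Irreducible (superellipticPoly K (AlgebraicClosure K) p (fK)))]
  [hirrκ : Fact (Irreducible (superellipticPoly (𝓞 K ⧸ 𝔭.asIdeal) (absIntegers (𝓞 K) K ⧸ 𝔓) p (fk)))]

/-! ### The deck group: inverses and integrality -/

omit [NumberField K] hp h𝔓m hirrK hirrκ in
/-- `(ζ⁻¹).val = ζ.val⁻¹`. [folklore] -/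
theorem _root_.Literature.NumberTheory.GaloisRepresentations.CyclicCoverDeck.val_inv' {L : Type*} [Field L] {m : ℕ}
    (ζ : CyclicCoverDeck L m) : (ζ⁻¹).val = ζ.val⁻¹ := by
  have h : (ζ⁻¹).val * ζ.val = 1 := by rw [← CyclicCoverDeck.val_mul, inv_mul_cancel, CyclicCoverDeck.val_one]
  exact eq_inv_of_mul_eq_one_left h

omit [NumberField K] hp hirrK hirrκ in
/-- `ζ.val⁻¹ ∈ ℤ̄_𝔓` (a root of unity). [folklore] -/
theorem val_inv_mem [NeZero p] (ζ : CyclicCoverDeck K̄ p) : ζ.val⁻¹ ∈ absIntegersLocalization 𝔓 := by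
  rw [← CyclicCoverDeck.val_inv', ← CyclicCoverDeck.coe_toAbsIntegers]
  exact coe_mem_absIntegersLocalization 𝔓 _

omit [NumberField K] hp hirrK hirrκ in
/-- `ζ.val⁻¹ mod 𝔓 = (ζ mod 𝔓).val⁻¹`. [folklore] -/
theorem residue_val_inv [NeZero p] (ζ : CyclicCoverDeck K̄ p) :
    absIntegersResidue 𝔓 ⟨ζ.val⁻¹, val_inv_mem ζ⟩ = (CyclicCoverDeck.reduceMod K p 𝔓 ζ).val⁻¹ := by
  have h : (⟨ζ.val⁻¹, val_inv_mem ζ⟩ : absIntegersLocalization 𝔓) =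
      ⟨(CyclicCoverDeck.toAbsIntegers ζ⁻¹ : K̄), coe_mem_absIntegersLocalization 𝔓 _⟩ :=
    Subtype.ext (by rw [CyclicCoverDeck.coe_toAbsIntegers, CyclicCoverDeck.val_inv'])
  rw [h, absIntegersResidue_coe, ← CyclicCoverDeck.val_reduceMod, map_inv, CyclicCoverDeck.val_inv']

/-! ### Reduction of places commutes with the decomposition group and the deck group -/

section Equivariance

variable {ζ₀ : K̄} (hζ₀ : IsPrimitiveRoot ζ₀ p) {ζ₀' : κ} (hζ₀' : IsPrimitiveRoot ζ₀' p)
  (hsepK : (fK).Separable) (hsepk : (fk).Separable) (hndvdk : ¬ p ∣ (fk).natDegree)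
include hζ₀ hζ₀' hsepK hsepk hndvdk

/-- **Reduction of places is `D_𝔓`-equivariant**: `(τ Q)‾ = τ̄ Q̄` for `τ` in the decomposition group of `𝔓`,
`τ̄` its image in `Aut(κ/k)` (integral points go to integral points, `(τ a)‾ = τ̄ ā`; `∞` and the places of
non-integral points go to `∞̄`, which `τ̄` fixes). [cite: Deuring1942Reduktion, §2] -/
theorem redPlace_smul (τ : MulAction.stabilizer (absoluteGaloisGroup K) 𝔓) (Q : PlaceOver K̄ FK) :
    redPlace 𝔭 𝔓 ((τ : absoluteGaloisGroup K) • Q) =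
      Ideal.Quotient.stabilizerHom 𝔓 𝔭.asIdeal (absoluteGaloisGroup K) τ • redPlace 𝔭 𝔓 Q := by
  haveI : IsAlgClosed κ := absIntegers.isAlgClosed_quotient 𝔓
  set σ := Ideal.Quotient.stabilizerHom 𝔓 𝔭.asIdeal (absoluteGaloisGroup K) τ with hσ
  by_cases h : ∃ a b : 𝒪, (b : K̄) ^ p = ((fK).map (algebraMap K K̄)).eval (a : K̄) ∧
      Q = pointPlace K K̄ p (fK) (a : K̄) (b : K̄)
  · obtain ⟨a, b, hb, rfl⟩ := h
    set a' : 𝒪 := ⟨(τ : absoluteGaloisGroup K) • (a : K̄), smul_mem_absIntegersLocalization 𝔓 τ a.2⟩ with ha'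
    set b' : 𝒪 := ⟨(τ : absoluteGaloisGroup K) • (b : K̄), smul_mem_absIntegersLocalization 𝔓 τ b.2⟩ with hb'def
    have hb' : (b' : K̄) ^ p = ((fK).map (algebraMap K K̄)).eval (a' : K̄) := pow_eq_eval_smul (τ : absoluteGaloisGroup K) hb
    have h1 : (τ : absoluteGaloisGroup K) • pointPlace K K̄ p (fK) (a : K̄) (b : K̄) = pointPlace K K̄ p (fK) (a' : K̄) (b' : K̄) :=
      smul_pointPlace hζ₀ hsepK _ hb
    rw [h1, redPlace_pointPlace hζ₀ hsepK a' b' hb', redPlace_pointPlace hζ₀ hsepK a b hb,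
      smul_pointPlace hζ₀' hsepk σ (residue_pow_eq_eval hb), AlgEquiv.smul_def, AlgEquiv.smul_def, hσ,
      ← absIntegersResidue_smul (𝔭 := 𝔭.asIdeal) 𝔓 τ a, ← absIntegersResidue_smul (𝔭 := 𝔭.asIdeal) 𝔓 τ b]
  · have h' : ¬ ∃ a b : 𝒪, (b : K̄) ^ p = ((fK).map (algebraMap K K̄)).eval (a : K̄) ∧
        (τ : absoluteGaloisGroup K) • Q = pointPlace K K̄ p (fK) (a : K̄) (b : K̄) := by
      rintro ⟨a, b, hb, hQ⟩
      apply h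
      set a' : 𝒪 := ⟨((τ⁻¹ : MulAction.stabilizer (absoluteGaloisGroup K) 𝔓) : absoluteGaloisGroup K) • (a : K̄),
        smul_mem_absIntegersLocalization 𝔓 τ⁻¹ a.2⟩
      set b' : 𝒪 := ⟨((τ⁻¹ : MulAction.stabilizer (absoluteGaloisGroup K) 𝔓) : absoluteGaloisGroup K) • (b : K̄),
        smul_mem_absIntegersLocalization 𝔓 τ⁻¹ b.2⟩
      refine ⟨a', b', pow_eq_eval_smul _ hb, ?_⟩
      rw [← smul_pointPlace hζ₀ hsepK _ hb, ← hQ, Subgroup.coe_inv, inv_smul_smul]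
    rw [redPlace, dif_neg h', redPlace, dif_neg h, smul_inftyPlace hndvdk]

/-- **Reduction of places commutes with the deck groups**: `(ζ Q)‾ = ζ̄ Q̄`, `ζ̄ = ζ mod 𝔓`. [cite: Deuring1942Reduktion, §2] -/
theorem redPlace_deck_smul [NeZero p] (ζ : CyclicCoverDeck K̄ p) (Q : PlaceOver K̄ FK) :
    redPlace 𝔭 𝔓 (ζ • Q) = CyclicCoverDeck.reduceMod K p 𝔓 ζ • redPlace 𝔭 𝔓 Q := by
  haveI : IsAlgClosed κ := absIntegers.isAlgClosed_quotient 𝔓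
  by_cases h : ∃ a b : 𝒪, (b : K̄) ^ p = ((fK).map (algebraMap K K̄)).eval (a : K̄) ∧
      Q = pointPlace K K̄ p (fK) (a : K̄) (b : K̄)
  · obtain ⟨a, b, hb, rfl⟩ := h
    set b' : 𝒪 := ⟨ζ.val⁻¹, val_inv_mem ζ⟩ * b with hb'def
    have hb' : (b' : K̄) ^ p = ((fK).map (algebraMap K K̄)).eval (a : K̄) := by
      rw [hb'def, Subring.coe_mul, mul_pow]
      change (ζ.val⁻¹) ^ p * (b : K̄) ^ p = _
      rw [inv_pow, ζ.val_pow, inv_one, one_mul, hb]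
    have h1 : ζ • pointPlace K K̄ p (fK) (a : K̄) (b : K̄) = pointPlace K K̄ p (fK) (a : K̄) (b' : K̄) :=
      deck_smul_pointPlace hζ₀ hsepK ζ hb
    rw [h1, redPlace_pointPlace hζ₀ hsepK a b' hb', redPlace_pointPlace hζ₀ hsepK a b hb,
      deck_smul_pointPlace hζ₀' hsepk _ (residue_pow_eq_eval hb), hb'def, map_mul, residue_val_inv]
  · have h' : ¬ ∃ a b : 𝒪, (b : K̄) ^ p = ((fK).map (algebraMap K K̄)).eval (a : K̄) ∧
        ζ • Q = pointPlace K K̄ p (fK) (a : K̄) (b : K̄) := by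
      rintro ⟨a, b, hb, hQ⟩
      apply h
      set b' : 𝒪 := ⟨(ζ⁻¹).val⁻¹, val_inv_mem ζ⁻¹⟩ * b
      have hb' : (b' : K̄) ^ p = ((fK).map (algebraMap K K̄)).eval (a : K̄) := by
        rw [Subring.coe_mul, mul_pow]
        change ((ζ⁻¹).val⁻¹) ^ p * (b : K̄) ^ p = _
        rw [inv_pow, CyclicCoverDeck.val_pow, inv_one, one_mul, hb]
      refine ⟨a, b', hb', ?_⟩
      rw [show pointPlace K K̄ p (fK) (a : K̄) (b' : K̄) = ζ⁻¹ • pointPlace K K̄ p (fK) (a : K̄) (b : K̄) from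
        (deck_smul_pointPlace hζ₀ hsepK ζ⁻¹ hb).symm, ← hQ, inv_smul_smul]
    rw [redPlace, dif_neg h', redPlace, dif_neg h, deck_smul_inftyPlace hndvdk]

attribute [local instance] Finsupp.comapSMul Finsupp.comapMulAction Finsupp.comapDistribMulAction

/-- **Reduction of divisors is `D_𝔓`-equivariant.** [cite: Deuring1942Reduktion, §2] -/
theorem redDiv_smul (τ : MulAction.stabilizer (absoluteGaloisGroup K) 𝔓) (D : Divisor K̄ FK) :
    redDiv 𝔭 𝔓 ((τ : absoluteGaloisGroup K) • D) =
      Ideal.Quotient.stabilizerHom 𝔓 𝔭.asIdeal (absoluteGaloisGroup K) τ • redDiv 𝔭 𝔓 D := by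
  rw [Finsupp.comapSMul_def, Finsupp.comapSMul_def, redDiv_apply_eq, redDiv_apply_eq, ← Finsupp.mapDomain_comp,
    ← Finsupp.mapDomain_comp]
  congr 1
  funext Q
  exact redPlace_smul hζ₀ hζ₀' hsepK hsepk hndvdk τ Q

/-- **Reduction of divisors commutes with the deck groups.** [cite: Deuring1942Reduktion, §2] -/
theorem redDiv_deck_smul [NeZero p] (ζ : CyclicCoverDeck K̄ p) (D : Divisor K̄ FK) :
    redDiv 𝔭 𝔓 (ζ • D) = CyclicCoverDeck.reduceMod K p 𝔓 ζ • redDiv 𝔭 𝔓 D := by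
  rw [Finsupp.comapSMul_def, Finsupp.comapSMul_def, redDiv_apply_eq, redDiv_apply_eq, ← Finsupp.mapDomain_comp,
    ← Finsupp.mapDomain_comp]
  congr 1
  funext Q
  exact redPlace_deck_smul hζ₀ hζ₀' hsepK hsepk hndvdk ζ Q

end Equivariance

/-! ### The reduction map on divisor classes -/

variable (𝔭 𝔓) in
/-- **Deuring's reduction map on divisor classes** `Pic(C_{f,K̄}) → Pic(C_{f̄,κ})`, `[D] ↦ [D̄]` (well defined because
principal divisors reduce to principal divisors, `principalDivisors_le_comap_redDiv`; the junk value `0` when that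
has not been established). [cite: Deuring1942Reduktion, §4] -/
def redPic : SuperellipticPic K K̄ p (fK) →+ SuperellipticPic k𝔭 κ p (fk) :=
  if h : principalDivisors K̄ FK ≤ (principalDivisors κ Fκ).comap (redDiv 𝔭 𝔓) then
    QuotientAddGroup.map (principalDivisors K̄ FK) (principalDivisors κ Fκ) (redDiv 𝔭 𝔓) h
  else 0

omit hp in
/-- `[D]‾ = [D̄]`. [folklore] -/
theorem redPic_mk (h : principalDivisors K̄ FK ≤ (principalDivisors κ Fκ).comap (redDiv 𝔭 𝔓)) (D : Divisor K̄ FK) :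
    redPic 𝔭 𝔓 (SuperellipticPic.mk D) = SuperellipticPic.mk (redDiv 𝔭 𝔓 D) := by
  rw [redPic, dif_pos h]
  rfl

section PicEquivariance

variable (hp𝔭 : (p : 𝓞 K) ∉ 𝔭.asIdeal) {ζ₀ : K̄} (hζ₀ : IsPrimitiveRoot ζ₀ p) {ζ₀' : κ} (hζ₀' : IsPrimitiveRoot ζ₀' p)
  (hsepK : (fK).Separable) (hsepk : (fk).Separable) (hndvdk : ¬ p ∣ (fk).natDegree)
include hp𝔭 hζ₀ hζ₀' hsepK hsepk hndvdk

/-- `[D]‾ = [D̄]` under the standing hypotheses. [folklore] -/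
theorem redPic_mk' (D : Divisor K̄ FK) : redPic 𝔭 𝔓 (SuperellipticPic.mk D) = SuperellipticPic.mk (redDiv 𝔭 𝔓 D) :=
  redPic_mk (principalDivisors_le_comap_redDiv hp𝔭 hζ₀ hζ₀' hsepK hsepk hndvdk) D

/-- **The reduction map is `D_𝔓`-equivariant**: `red(τ c) = τ̄ red(c)`. [cite: Deuring1942Reduktion, §4] -/
theorem redPic_smul (τ : MulAction.stabilizer (absoluteGaloisGroup K) 𝔓) (c : SuperellipticPic K K̄ p (fK)) :
    redPic 𝔭 𝔓 ((τ : absoluteGaloisGroup K) • c) =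
      Ideal.Quotient.stabilizerHom 𝔓 𝔭.asIdeal (absoluteGaloisGroup K) τ • redPic 𝔭 𝔓 c := by
  obtain ⟨D, rfl⟩ := SuperellipticPic.mk_surjective c
  rw [SuperellipticPic.smul_mk, redPic_mk' hp𝔭 hζ₀ hζ₀' hsepK hsepk hndvdk, redPic_mk' hp𝔭 hζ₀ hζ₀' hsepK hsepk hndvdk,
    redDiv_smul hζ₀ hζ₀' hsepK hsepk hndvdk, SuperellipticPic.smul_mk]

/-- **The reduction map commutes with the deck groups**: `red(ζ c) = ζ̄ red(c)`. [cite: Deuring1942Reduktion, §4] -/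
theorem redPic_deck_smul [NeZero p] (ζ : CyclicCoverDeck K̄ p) (c : SuperellipticPic K K̄ p (fK)) :
    redPic 𝔭 𝔓 (ζ • c) = CyclicCoverDeck.reduceMod K p 𝔓 ζ • redPic 𝔭 𝔓 c := by
  obtain ⟨D, rfl⟩ := SuperellipticPic.mk_surjective c
  rw [SuperellipticPic.deck_smul_mk, redPic_mk' hp𝔭 hζ₀ hζ₀' hsepK hsepk hndvdk,
    redPic_mk' hp𝔭 hζ₀ hζ₀' hsepK hsepk hndvdk, redDiv_deck_smul hζ₀ hζ₀' hsepK hsepk hndvdk,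
    SuperellipticPic.deck_smul_mk]

/-- **The reduction preserves degrees of classes.** [cite: Deuring1942Reduktion, §4] -/
theorem degree_redPic (c : SuperellipticPic K K̄ p (fK)) :
    SuperellipticPic.degree k𝔭 κ p (fk) (redPic 𝔭 𝔓 c) = SuperellipticPic.degree K K̄ p (fK) c := by
  obtain ⟨D, rfl⟩ := SuperellipticPic.mk_surjective c
  rw [redPic_mk' hp𝔭 hζ₀ hζ₀' hsepK hsepk hndvdk, SuperellipticPic.degree_mk, SuperellipticPic.degree_mk, degree_redDiv]

end PicEquivariance

end SuperellipticReduction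

namespace SuperellipticReduction

variable {K : Type} [Field K] [NumberField K] {p : ℕ} [hp : Fact p.Prime] {f₀ : (𝓞 K)[X]}
variable {𝔭 : HeightOneSpectrum (𝓞 K)} {𝔓 : Ideal (absIntegers (𝓞 K) K)} [h𝔓m : 𝔓.IsMaximal] [h𝔓 : 𝔓.LiesOver 𝔭.asIdeal]

set_option hygiene false in
local notation "K̄" => AlgebraicClosure K
set_option hygiene false in
local notation "𝒪" => absIntegersLocalization 𝔓
set_option hygiene false in
local notation "κ" => (absIntegers (𝓞 K) K ⧸ 𝔓)
set_option hygiene false in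
local notation "k𝔭" => (𝓞 K ⧸ 𝔭.asIdeal)
set_option hygiene false in
local notation "fK" => (Polynomial.map (algebraMap (𝓞 K) K) f₀)
set_option hygiene false in
local notation "fk" => (Polynomial.map (Ideal.Quotient.mk 𝔭.asIdeal) f₀)
set_option hygiene false in
local notation "FK" => SuperellipticFunctionField K (AlgebraicClosure K) p (Polynomial.map (algebraMap (𝓞 K) K) f₀)
set_option hygiene false in
local notation "Fκ" =>
  SuperellipticFunctionField (𝓞 K ⧸ 𝔭.asIdeal) (absIntegers (𝓞 K) K ⧸ 𝔓) p (Polynomial.map (Ideal.Quotient.mk 𝔭.asIdeal) f₀)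
set_option hygiene false in
/-- evaluation in the generic fibre -/
local notation "ev" =>
  polyEval K p (Polynomial.map (algebraMap (𝓞 K) K) f₀) (absIntegersLocalization 𝔓).subtype
set_option hygiene false in
/-- evaluation in the special fibre -/
local notation "evκ" =>
  polyEval (𝓞 K ⧸ 𝔭.asIdeal) p (Polynomial.map (Ideal.Quotient.mk 𝔭.asIdeal) f₀) (absIntegersResidue 𝔓)
set_option hygiene false in
/-- the model `Y^p - f_𝒪` -/
local notation "gmod" => ((X : (absIntegersLocalization 𝔓)[X][Y]) ^ p - C (fLoc f₀ 𝔓))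

variable [hirrK : Fact (Irreducible (superellipticPoly K (AlgebraicClosure K) p (fK)))]
  [hirrκ : Fact (Irreducible (superellipticPoly (𝓞 K ⧸ 𝔭.asIdeal) (absIntegers (𝓞 K) K ⧸ 𝔓) p (fk)))]

/-! ### The roots of `f` reduce bijectively onto the roots of `f̄` -/

omit [NumberField K] hp h𝔓m h𝔓 hirrK hirrκ in
/-- `rootSet` versus `roots` of the mapped polynomial. [folklore] -/
theorem mem_roots_of_mem_rootSet {T S : Type*} [CommRing T] [CommRing S] [IsDomain S] [Algebra T S] {q : T[X]} {a : S}
    (h : a ∈ q.rootSet S) : a ∈ (q.map (algebraMap T S)).roots := by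
  rwa [rootSet_def, Finset.mem_coe, Multiset.mem_toFinset, aroots_def] at h

omit [NumberField K] hp h𝔓m h𝔓 hirrK hirrκ in
/-- `roots` of the mapped polynomial versus `rootSet`. [folklore] -/
theorem mem_rootSet_of_mem_roots {T S : Type*} [CommRing T] [CommRing S] [IsDomain S] [Algebra T S] {q : T[X]} {a : S}
    (h : a ∈ (q.map (algebraMap T S)).roots) : a ∈ q.rootSet S := by
  rwa [rootSet_def, Finset.mem_coe, Multiset.mem_toFinset, aroots_def]

section Roots

variable (hsepk : (fk).Separable) (hdeg : (fk).natDegree = f₀.natDegree)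
include hsepk hdeg

omit hp hirrK hirrκ in
/-- Roots of `f` in `K̄` are `𝔓`-integral (`deg f̄ = deg f`). [folklore] -/
theorem mem_of_mem_rootSet {α : K̄} (hα : α ∈ (fK).rootSet K̄) : α ∈ absIntegersLocalization 𝔓 :=
  mem_of_isRoot hsepk hdeg (isRoot_of_mem_rootSet hα)

omit hp hirrK hirrκ in
/-- The reduction of a root of `f` is a root of `f̄`. [folklore] -/
theorem residue_mem_rootSet {α : K̄} (hα : α ∈ (fK).rootSet K̄) :
    absIntegersResidue 𝔓 ⟨α, mem_of_mem_rootSet hsepk hdeg hα⟩ ∈ (fk).rootSet κ := by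
  rw [mem_rootSet]
  refine ⟨hsepk.ne_zero, ?_⟩
  have h1 : (fLoc f₀ 𝔓).eval ⟨α, mem_of_mem_rootSet hsepk hdeg hα⟩ = 0 :=
    Subtype.ext (by rw [coe_eval_fLoc]; exact isRoot_of_mem_rootSet hα)
  rw [aeval_def, ← eval_map, ← residue_eval_fLoc (𝔭 := 𝔭), h1, map_zero]

variable (𝔓) in
/-- **The reduction map on roots** `R_f → R_f̄`, `α ↦ ᾱ`. [folklore] -/
def rootRed (α : (fK).rootSet K̄) : (fk).rootSet κ :=
  ⟨absIntegersResidue 𝔓 ⟨α, mem_of_mem_rootSet hsepk hdeg α.2⟩, residue_mem_rootSet hsepk hdeg α.2⟩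

omit hp hirrK hirrκ in
/-- `(rootRed α : κ) = ᾱ`. [folklore] -/
theorem coe_rootRed (α : (fK).rootSet K̄) :
    ((rootRed 𝔓 hsepk hdeg α : (fk).rootSet κ) : κ) = absIntegersResidue 𝔓 ⟨α, mem_of_mem_rootSet hsepk hdeg α.2⟩ := rfl

omit hp hirrK hirrκ in
/-- All roots of `f` over `K̄` lie in `ℤ̄_𝔓`, so the root multiset of `f̄` is the reduction of that of `f`. [folklore] -/
theorem roots_fk_map :
    ((fk).map (algebraMap k𝔭 κ)).roots = (((fK).map (algebraMap K K̄)).roots).map (absIntegersResidue' 𝔓) := by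
  have h0 : (fLoc f₀ 𝔓).map (absIntegersResidue 𝔓) ≠ 0 := by
    rw [fLoc_map_residue (𝔭 := 𝔭)]
    exact Polynomial.map_ne_zero hsepk.ne_zero
  have h := roots_map_absIntegersResidue 𝔓 _ h0
  rw [fLoc_map_residue (𝔭 := 𝔭), fLoc_map_subtype] at h
  rw [h, Multiset.filter_eq_self.2]
  intro α hα
  exact mem_of_mem_rootSet hsepk hdeg (mem_rootSet_of_mem_roots hα)

omit hp hirrK hirrκ in
/-- **`α ↦ ᾱ` is a bijection `R_f → R_f̄`** (`f̄` separable of the same degree). [folklore] -/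
theorem rootRed_bijective : Function.Bijective (rootRed (𝔭 := 𝔭) (f₀ := f₀) 𝔓 hsepk hdeg) := by
  have hnodup : (((fK).map (algebraMap K K̄)).roots.map (absIntegersResidue' 𝔓)).Nodup := by
    rw [← roots_fk_map hsepk hdeg]
    exact nodup_roots (hsepk.map)
  constructor
  · intro α β h
    apply Subtype.ext
    have h' : absIntegersResidue' 𝔓 (α : K̄) = absIntegersResidue' 𝔓 (β : K̄) := by
      rw [absIntegersResidue'_of_mem 𝔓 (mem_of_mem_rootSet hsepk hdeg α.2),
        absIntegersResidue'_of_mem 𝔓 (mem_of_mem_rootSet hsepk hdeg β.2)]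
      exact congrArg Subtype.val h
    exact Multiset.inj_on_of_nodup_map hnodup _ (mem_roots_of_mem_rootSet α.2) _ (mem_roots_of_mem_rootSet β.2) h'
  · intro β
    have hβ : (β : κ) ∈ ((fk).map (algebraMap k𝔭 κ)).roots := mem_roots_of_mem_rootSet β.2
    rw [roots_fk_map hsepk hdeg, Multiset.mem_map] at hβ
    obtain ⟨α, hα, hαβ⟩ := hβ
    have hα' : α ∈ (fK).rootSet K̄ := mem_rootSet_of_mem_roots hα
    refine ⟨⟨α, hα'⟩, Subtype.ext ?_⟩
    rw [coe_rootRed, ← absIntegersResidue'_of_mem 𝔓 (mem_of_mem_rootSet hsepk hdeg hα'), hαβ]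

variable (𝔓) in
/-- **The reduction bijection on roots** `R_f ≃ R_f̄`. [folklore] -/
def rootEquiv : (fK).rootSet K̄ ≃ (fk).rootSet κ :=
  Equiv.ofBijective _ (rootRed_bijective (𝔓 := 𝔓) hsepk hdeg)

omit hp hirrK hirrκ in
/-- `rootEquiv α = ᾱ`. [folklore] -/
theorem coe_rootEquiv (α : (fK).rootSet K̄) :
    ((rootEquiv 𝔓 hsepk hdeg α : (fk).rootSet κ) : κ) = absIntegersResidue 𝔓 ⟨α, mem_of_mem_rootSet hsepk hdeg α.2⟩ := rfl

end Roots

/-! ### The reduction is injective on `J[λ]` -/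

section LambdaInj

variable (hp𝔭 : (p : 𝓞 K) ∉ 𝔭.asIdeal) {ζ₀ : K̄} (hζ₀ : IsPrimitiveRoot ζ₀ p) {ζ₀' : κ} (hζ₀' : IsPrimitiveRoot ζ₀' p)
  (hsepK : (fK).Separable) (hsepk : (fk).Separable) (hndvdK : ¬ p ∣ (fK).natDegree) (hndvdk : ¬ p ∣ (fk).natDegree)
  (hdeg : (fk).natDegree = f₀.natDegree)
include hζ₀ hζ₀' hsepK hsepk hdeg

/-- **`T_α` reduces to `T_ᾱ`.** [cite: Deuring1942Reduktion, §2] -/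
theorem redPlace_rootPlace (α : (fK).rootSet K̄) :
    redPlace 𝔭 𝔓 (rootPlace K K̄ p (fK) (α : K̄)) = rootPlace k𝔭 κ p (fk) ((rootEquiv 𝔓 hsepk hdeg α : (fk).rootSet κ) : κ) := by
  haveI : IsAlgClosed κ := absIntegers.isAlgClosed_quotient 𝔓
  set a : 𝒪 := ⟨α, mem_of_mem_rootSet hsepk hdeg α.2⟩ with ha
  have hroot : ((fK).map (algebraMap K K̄)).eval (a : K̄) = 0 := isRoot_of_mem_rootSet α.2
  have hb : ((0 : 𝒪) : K̄) ^ p = ((fK).map (algebraMap K K̄)).eval (a : K̄) := by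
    rw [ZeroMemClass.coe_zero, zero_pow hp.out.ne_zero, hroot]
  have hroot' : ((fk).map (algebraMap k𝔭 κ)).eval (absIntegersResidue 𝔓 a) = 0 := by
    have h := residue_pow_eq_eval (𝔭 := 𝔭) hb
    rwa [map_zero, zero_pow hp.out.ne_zero, eq_comm] at h
  have h1 : rootPlace K K̄ p (fK) (α : K̄) = pointPlace K K̄ p (fK) (a : K̄) ((0 : 𝒪) : K̄) := by
    rw [ZeroMemClass.coe_zero, pointPlace_zero_eq_rootPlace hζ₀ hsepK hroot]
  rw [h1, redPlace_pointPlace hζ₀ hsepK a 0 hb, map_zero, pointPlace_zero_eq_rootPlace hζ₀' hsepk hroot', coe_rootEquiv]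

/-- **`T_α - ∞` reduces to `T_ᾱ - ∞̄`.** [cite: Deuring1942Reduktion, §2] -/
theorem redDiv_genDivInf (α : (fK).rootSet K̄) :
    redDiv 𝔭 𝔓 (genDivInf K p (fK) α) = genDivInf k𝔭 p (fk) (rootEquiv 𝔓 hsepk hdeg α) := by
  rw [genDivInf, genDivInf, map_sub, redDiv_single, redDiv_single, redPlace_rootPlace hζ₀ hζ₀' hsepK hsepk hdeg,
    redPlace_inftyPlace hζ₀ hsepK]

/-- `(∑ ã_α (T_α - ∞))‾ = ∑ ã_α (T_ᾱ - ∞̄)`. [folklore] -/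
theorem redDiv_liftDivInf (x : (fK).rootSet K̄ →₀ ZMod p) :
    redDiv 𝔭 𝔓 (liftDivInf K p (fK) x) = liftDivInf k𝔭 p (fk) (x.equivMapDomain (rootEquiv 𝔓 hsepk hdeg)) := by
  rw [liftDivInf, liftDivInf, map_sum]
  refine Fintype.sum_equiv (rootEquiv 𝔓 hsepk hdeg) _ _ fun α => ?_
  rw [map_zsmul, redDiv_genDivInf hζ₀ hζ₀' hsepK hsepk hdeg, Finsupp.equivMapDomain_apply, Equiv.symm_apply_apply]

omit hζ₀ hζ₀' hsepK hsepk hdeg in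
/-- Reindexing along a bijection preserves the augmentation (sum of coefficients). [folklore] -/
theorem augmentation_equivMapDomain {ι₁ ι₂ : Type*} [Fintype ι₁] [Fintype ι₂] (e : ι₁ ≃ ι₂) (x : ι₁ →₀ ZMod p) :
    augmentation (ZMod p) ι₂ (x.equivMapDomain e) = augmentation (ZMod p) ι₁ x := by
  rw [augmentation, augmentation, Finsupp.linearCombination_apply, Finsupp.linearCombination_apply,
    Finsupp.sum_fintype _ (fun _ a => a • (1 : ZMod p)) (fun _ => zero_smul _ _),
    Finsupp.sum_fintype _ (fun _ a => a • (1 : ZMod p)) (fun _ => zero_smul _ _)]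
  exact (Fintype.sum_equiv e _ _ fun a => by rw [Finsupp.equivMapDomain_apply, Equiv.symm_apply_apply]).symm

include hndvdK hndvdk in
/-- **The reduction is injective on `J[λ]`**: a class `[∑ ã_α (T_α - ∞)]` whose reduction `[∑ ã_α (T_ᾱ - ∞̄)]`
vanishes has `a` constant (injectivity of `Ψ` on the special fibre, `psiInf_injective`, and `α ↦ ᾱ` bijective),
hence vanishes. [cite: Deuring1942Reduktion, §4] -/
theorem eq_zero_of_mem_lambdaTorsion_of_redPic_eq_zero
    (hle : principalDivisors K̄ FK ≤ (principalDivisors κ Fκ).comap (redDiv 𝔭 𝔓))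
    {c : SuperellipticPic K K̄ p (fK)} (hc : c ∈ lambdaTorsion K K̄ p (fK)) (h0 : redPic 𝔭 𝔓 c = 0) : c = 0 := by
  haveI : IsAlgClosed κ := absIntegers.isAlgClosed_quotient 𝔓
  obtain ⟨v, rfl⟩ := exists_psiInf_eq hζ₀ hsepK hndvdK hc
  induction v using Submodule.Quotient.induction_on with
  | H x =>
    set e := rootEquiv (𝔭 := 𝔭) (f₀ := f₀) 𝔓 hsepk hdeg with he
    rw [psiInf_mk] at h0 ⊢
    rw [picMk_apply, redPic_mk hle, redDiv_liftDivInf hζ₀ hζ₀' hsepK hsepk hdeg, ← picMk_apply] at h0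
    -- the reindexed coefficient vector is sum-zero
    have hx' : (x : (fK).rootSet K̄ →₀ ZMod p).equivMapDomain e ∈ augmentationSubmodule (ZMod p) ((fk).rootSet κ) := by
      rw [mem_augmentationSubmodule_iff, augmentation_equivMapDomain, ← mem_augmentationSubmodule_iff]
      exact x.2
    set x' : augmentationSubmodule (ZMod p) ((fk).rootSet κ) := ⟨_, hx'⟩ with hx'def
    have h1 : psiInf (K := k𝔭) hsepk hndvdk (Submodule.Quotient.mk x') = 0 := by
      rw [psiInf_mk]; exact h0
    have h2 : (Submodule.Quotient.mk x' : Heart p ((fk).rootSet κ)) = 0 :=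
      (injective_iff_map_eq_zero _).1 (psiInf_injective (K := k𝔭) hζ₀' hsepk hndvdk) _ h1
    rw [Submodule.Quotient.mk_eq_zero, mem_augmentationConst] at h2
    obtain ⟨a, ha⟩ := h2
    have h3 : (Submodule.Quotient.mk x : Heart p ((fK).rootSet K̄)) = 0 := by
      rw [Submodule.Quotient.mk_eq_zero, mem_augmentationConst]
      refine ⟨a, ?_⟩
      ext α
      have h4 := DFunLike.congr_fun ha (e α)
      rw [Finsupp.smul_apply, constFinsupp_apply] at h4 ⊢
      rw [h4, hx'def]
      exact (Finsupp.equivMapDomain_apply e _ (e α)).trans (by rw [Equiv.symm_apply_apply])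
    rw [← psiInf_mk hsepK hndvdK, h3, map_zero]

end LambdaInj

end SuperellipticReduction

end Literature.NumberTheory.GaloisRepresentations
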